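/-
Copyright (c) 2026 the pub-hodgecm-mathlib formalisation cell (harness21).  Prover seat hodgecm-mathlib-K2E1-p12 (g7), Track B ∕ R90-TF, h413 = `stmt-HodgeConjecture-24833`,
R90-TF section S8 «ContSpec-n½», socket (E) :276, E1-PLANCHEREL BODY brick PB-2a′ (S8 dealer R90-CS-plan (g4) S8-R254 (8)+(13), S8-R263 (1)): the VECTOR ∕ OPERATOR edition of
the axis-generic contour shift ★ PB-2a `K2E1PseudoEisensteinContourShiftAxisGeneric`, its `U(2,1)` head (axis `Re z = 1`, reflection point `2`, `σ₀ > 2`), and the axis adapter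
`z̄ − 2κ = −z` on `Re z = κ`.
-/
import Summits.HodgeConjecture.HodgeConjecture.Theorems.K2E1PseudoEisensteinContourShiftAxisGeneric   -- ★ PB-2a (this seat): scalar axis-generic shift with Gram constant; brings ★ T4b-multi, ★ C4-multi, ★ A
import Summits.HodgeConjecture.HodgeConjecture.Theorems.K2E1PseudoEisensteinContourShiftVector        -- ★ D4′c (SD) part 2 (K2E4-p10): `sum_sum_mul_sum_comm`, `inner_sum_smul_sum_smul`, `vectorResidue_eq_sum_sum` (axis-free algebra)
import Mathlib.Analysis.InnerProductSpace.Basic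
import HarnessLib

/-!
# PB-2a′ — `K2E1PseudoEisensteinContourShiftVectorAxisGeneric`: the vector two-term inner-product integrand (finite sums of pure tensors, operator intertwining datum) moved from
# `Re z = σ₀` to an arbitrary axis `Re z = κ` across finitely many simple real poles; the `U(2,1)` head; the axis adapter (pure analysis + linear algebra, on letters)

Track B ∕ R90-TF, crux h413 = `stmt-HodgeConjecture-24833`, route of record `HCCMUnconditional`; cell `hodgecm-mathlib`, R90-TF programme, section S8 «ContSpec-n½», socket (E)
(B ED. 7 :276): the E1-PLANCHEREL BODY at the τ-cut block, bricks PB-1…PB-4 (S8-R254; joint census `R90/S8/CENSUS-PlancherelBody-bricks.K2E1-p16-F0P2-p10.md`).  THIS FILE = PB-2a′.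
THEOREMS ONLY (no `def`, no `instance`, no `notation`, no named-fact hypothesis, no `sorry`; default heartbeats); lane `--supports stmt-HodgeConjecture-24833 --as helper`
(count-neutral).  No automorphic object.  CLOSES NO SOCKET.

THE MATHEMATICS ([MoeglinWaldspurger1995, II.2.1–II.2.4, IV.1.11]; [Titchmarsh1939, §3.12]).  At a `K`-type cut the section space `V` (the `(τ, K′_f)`-isotypic pair sections) is a
finite-dimensional complex inner-product space; a section field is a finite sum of pure tensors `Ψ = Σ_a f_a ⊗ φ_a` (`f_a ∈ C²_c((0,∞))`, `φ_a ∈ V`) with VECTOR transform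
`Ψ̂(w) = Σ_a f̃_a(w)•φ_a`, `f̃ = mellin f`; the continued intertwining datum `M(z) = M(w₀, z)|_V ∈ End V` is OPERATOR-valued.  PB-1 writes the inner product of two such wave packets as
`IP = C·(2π)⁻¹∫_ℝ F(σ₀+iy) dy` (`σ₀ > ρ`, `ρ = 2` for `U(2,1)`) with **`F(z) = ⟪Ψ̂′(z̄ − ρ), Ψ̂(−z)⟫_V + ⟪Ψ̂′(−z̄), M(z)Ψ̂(−z)⟫_V`** — by sesquilinearity (★ `inner_sum_smul_sum_smul`) the sum over
entries `(a,b)` of ★ PB-2a's two-term integrand with Gram constant `g_{ab} = ⟪φ′_b, φ_a⟫` and scalar `s_{ab}(z) = ⟪φ′_b, M(z)φ_a⟫` (§1).  Shifting every entry with ★ PB-2a (letters PER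
ENTRY: `hs` holomorphy of `s_{ab}` on an open `U ⊇ {κ ≤ Re z ≤ σ₀}` off a finset `S ⊂ (κ, σ₀)` of real poles, `hr` residues `(z − c)s_{ab}(z) → ⟪φ′_b, R_c φ_a⟫` with `R_c ∈ End V`, `hB`
strip bound), summing (§1, ★ `sum_sum_mul_sum_comm`) and reassembling the residues `Σ_{ab} ⟪φ′_b, R_c φ_a⟫·f̃_a(−c)·conj f̃′_b(−c) = ⟪Ψ̂′(−c), R_c Ψ̂(−c)⟫` (★ `vectorResidue_eq_sum_sum`) gives
(§2 HEAD) **`IP = C·(Σ_{c∈S} ⟪Ψ̂′(−c), R_c Ψ̂(−c)⟫_V) + C·((2π)⁻¹·∫_ℝ F(κ+iy) dy)`** — ★ `K2E1PseudoEisensteinContourShiftVector.pseudoEisenstein_contourShift_vector_of_letters` with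
`(½, 1) ↦ (κ, ρ)`.  §3: ON THE AXIS `Re z = κ` with `ρ = 2κ` one has `z̄ − ρ = −z` (`axis_conj_sub_two_mul`), so the shifted first term reads `⟪Ψ̂′(−z), Ψ̂(−z)⟫` — the `A(t) = Ψ̂(−(κ+it))`
currency of ★ `K2E1PseudoEisensteinPlancherelIsometryOperator` (PB-2b).  §4: the `U(2,1)` HEAD (`κ = 1`, `ρ = 2`, `σ₀ > 2`, poles `S ⊂ (1, σ₀)` — in the application `S ⊆ {2, 3∕2}`:
`z = 2` the top residues `Θ∘det`, `z = 3∕2` the middle residues `π_ξ`), axis term already in the `⟪Ψ̂′(−z), Ψ̂(−z)⟫ + ⟪Ψ̂′(−z̄), M(z)Ψ̂(−z)⟫` form at `z = 1 + iy`.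
* §1 `vectorIntegrand_eq_sum_sum_axis`, `sum_sum_integral_twoTermIntegrand_eq`, `integrable_vectorIntegrand_vertical_axis`.
* §2 HEAD **`pseudoEisenstein_contourShift_vector_axis_of_letters`**.  * §3 `axis_conj_sub_two_mul`, `vectorIntegrand_axis_eq`.  * §4 **`pseudoEisenstein_contourShift_vector_cm_three`**.
HONEST LABEL: HC_CM is proved only modulo the 7 printed citations (2 remaining named inputs: hLiu418 = `stmt-HodgeConjecture-24832`, h413 = `stmt-HodgeConjecture-24833`) until rung 0
closes; this file asserts no named fact, closes no socket; count-neutral; letters at instantiation (the XL analytic core of census PB-2, NOT paid here): `hs∕hr∕hB` per entry for the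
matrix coefficients `z ↦ ⟪φ′, M(w₀,z)φ⟫_{K_U}` on a neighbourhood of `{1 ≤ Re z ≤ σ₀}` with simple real poles (T-estate ∕ Maass–Selberg currency), and PB-1's `hIP`.

## References
* [MoeglinWaldspurger1995] C. Mœglin, J.-L. Waldspurger, *Spectral decomposition and Eisenstein series* (1995), II.2.1–II.2.4, IV.1.11.
* [Titchmarsh1939] E. C. Titchmarsh, *The Theory of Functions* (2nd ed., 1939), §3.12.
-/

set_option autoImplicit false
set_option linter.dupNamespace false  -- the mandated namespace repeats the summit's segment (`HodgeConjecture.HodgeConjecture`)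

noncomputable section

open MeasureTheory Measure Set Filter Topology Complex
open scoped Real ComplexConjugate InnerProductSpace BigOperators
open Summit.HodgeConjecture.HodgeConjecture.Cruxes.H413.K2E1PseudoEisensteinContourShiftAxisGeneric (integrable_twoTermIntegrand_vertical integral_twoTermIntegrand_eq_add_sum_residues)
open Summit.HodgeConjecture.HodgeConjecture.Cruxes.H413.K2E1PseudoEisensteinContourShiftVector (sum_sum_mul_sum_comm inner_sum_smul_sum_smul vectorResidue_eq_sum_sum)

namespace Summit.HodgeConjecture.HodgeConjecture.Cruxes.H413.K2E1PseudoEisensteinContourShiftVectorAxisGeneric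

variable {V : Type*} [NormedAddCommGroup V] [InnerProductSpace ℂ V] {α β : Type*} [Fintype α] [Fintype β]

/-! ## §1 The vector integrand as the sum of its entries; entrywise shift summed; integrability on lines -/

/-- **THE VECTOR INTEGRAND IS THE SUM OF ITS ENTRIES** (reflection point `ρ`): with `Ψ̂(w) = Σ_a f̃_a(w)•φ_a`, `Ψ̂′(w) = Σ_b f̃′_b(w)•φ′_b`,
`⟪Ψ̂′(z̄ − ρ), Ψ̂(−z)⟫ + ⟪Ψ̂′(−z̄), M(z)Ψ̂(−z)⟫ = Σ_{a,b} f̃_a(−z)·(⟪φ′_b, φ_a⟫·conj f̃′_b(z̄ − ρ) + ⟪φ′_b, M(z)φ_a⟫·conj f̃′_b(−z̄))` (sesquilinearity, ★ `inner_sum_smul_sum_smul`).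
[cite: MoeglinWaldspurger1995, II.2.1] -/
theorem vectorIntegrand_eq_sum_sum_axis (f : α → ℝ → ℂ) (f' : β → ℝ → ℂ) (φ : α → V) (φ' : β → V) (M : ℂ → V →ₗ[ℂ] V) (ρ z : ℂ) :
    ⟪∑ b, mellin (f' b) (conj z - ρ) • φ' b, ∑ a, mellin (f a) (-z) • φ a⟫_ℂ + ⟪∑ b, mellin (f' b) (-conj z) • φ' b, M z (∑ a, mellin (f a) (-z) • φ a)⟫_ℂ =
      ∑ a, ∑ b, mellin (f a) (-z) * (⟪φ' b, φ a⟫_ℂ * conj (mellin (f' b) (conj z - ρ)) + ⟪φ' b, M z (φ a)⟫_ℂ * conj (mellin (f' b) (-conj z))) := by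
  have h1 := inner_sum_smul_sum_smul (LinearMap.id : V →ₗ[ℂ] V) (fun b => mellin (f' b) (conj z - ρ)) (fun a => mellin (f a) (-z)) φ φ'
  have h2 := inner_sum_smul_sum_smul (M z) (fun b => mellin (f' b) (-conj z)) (fun a => mellin (f a) (-z)) φ φ'
  simp only [LinearMap.id_apply] at h1
  rw [h1, h2, ← Finset.sum_add_distrib]
  refine Finset.sum_congr rfl fun a _ => ?_
  rw [← Finset.sum_add_distrib]
  refine Finset.sum_congr rfl fun b _ => ?_
  ring

/-- **ENTRYWISE ★ PB-2a SUMMED OVER `(a, b) ∈ α × β`** (finite): with a COMMON open `U ⊇ {κ ≤ Re z ≤ σ₀}` and finset `S ⊂ (κ, σ₀)` of candidate poles,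
`Σ_{a,b} ∫_ℝ F_{ab}(σ₀+iy) dy = Σ_{a,b} ∫_ℝ F_{ab}(κ+iy) dy + 2π·Σ_{c∈S} Σ_{a,b} r_{ab}(c)·f̃_a(−c)·conj f̃′_b(−c)`. [cite: MoeglinWaldspurger1995, II.2.4] -/
theorem sum_sum_integral_twoTermIntegrand_eq {f : α → ℝ → ℂ} {f' : β → ℝ → ℂ}
    (hf : ∀ a, ContDiff ℝ 2 (f a)) (hfs : ∀ a, HasCompactSupport (f a)) (hf0 : ∀ a, tsupport (f a) ⊆ Ioi 0)
    (hf' : ∀ b, ContDiff ℝ 2 (f' b)) (hf's : ∀ b, HasCompactSupport (f' b)) (hf'0 : ∀ b, tsupport (f' b) ⊆ Ioi 0) {κ σ₀ : ℝ} (hσ₀ : κ < σ₀) (ρ : ℂ)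
    {U : Set ℂ} (hUo : IsOpen U) (hUs : {z : ℂ | κ ≤ z.re ∧ z.re ≤ σ₀} ⊆ U) (S : Finset ℝ) (hS : ∀ c ∈ S, κ < c ∧ c < σ₀)
    (g : α → β → ℂ) (s : α → β → ℂ → ℂ) (hs : ∀ a b, DifferentiableOn ℂ (s a b) (U \ ((S.image fun c : ℝ => (c : ℂ)) : Set ℂ)))
    (r : α → β → ℝ → ℂ) (hr : ∀ a b, ∀ c ∈ S, Tendsto (fun z : ℂ => (z - c) * s a b z) (𝓝[≠] (c : ℂ)) (𝓝 (r a b c)))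
    {B : ℝ} (hB : ∀ a b, ∀ z : ℂ, κ < z.re → z.re ≤ σ₀ → 1 ≤ |z.im| → ‖s a b z‖ ≤ B) :
    ∑ a, ∑ b, ∫ y : ℝ, mellin (f a) (-((σ₀ : ℂ) + y * I)) *
        (g a b * conj (mellin (f' b) (conj ((σ₀ : ℂ) + y * I) - ρ)) + s a b ((σ₀ : ℂ) + y * I) * conj (mellin (f' b) (-conj ((σ₀ : ℂ) + y * I)))) =
      (∑ a, ∑ b, ∫ y : ℝ, mellin (f a) (-((κ : ℂ) + y * I)) *
          (g a b * conj (mellin (f' b) (conj ((κ : ℂ) + y * I) - ρ)) + s a b ((κ : ℂ) + y * I) * conj (mellin (f' b) (-conj ((κ : ℂ) + y * I))))) +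
        2 * π * ∑ c ∈ S, ∑ a, ∑ b, r a b c * (mellin (f a) (-(c : ℂ)) * conj (mellin (f' b) (-(c : ℂ)))) := by
  have h : ∀ a b, ∫ y : ℝ, mellin (f a) (-((σ₀ : ℂ) + y * I)) *
        (g a b * conj (mellin (f' b) (conj ((σ₀ : ℂ) + y * I) - ρ)) + s a b ((σ₀ : ℂ) + y * I) * conj (mellin (f' b) (-conj ((σ₀ : ℂ) + y * I)))) =
      (∫ y : ℝ, mellin (f a) (-((κ : ℂ) + y * I)) *
          (g a b * conj (mellin (f' b) (conj ((κ : ℂ) + y * I) - ρ)) + s a b ((κ : ℂ) + y * I) * conj (mellin (f' b) (-conj ((κ : ℂ) + y * I))))) +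
        2 * π * ∑ c ∈ S, r a b c * (mellin (f a) (-(c : ℂ)) * conj (mellin (f' b) (-(c : ℂ)))) := fun a b =>
    integral_twoTermIntegrand_eq_add_sum_residues (hf a) (hfs a) (hf0 a) (hf' b) (hf's b) (hf'0 b) ρ (g a b) hσ₀ hUo hUs (hs a b) hS (hr a b) (hB a b)
  rw [Finset.sum_congr rfl fun a _ => Finset.sum_congr rfl fun b _ => h a b]
  simp only [Finset.sum_add_distrib]
  rw [sum_sum_mul_sum_comm]

/-- **THE VECTOR INTEGRAND IS `L¹` ON EVERY LINE OF THE CLOSED STRIP OFF THE POLES** (`σ ∈ [κ, σ₀]`, `σ ∉ S`): a finite sum of the integrable entries (★ PB-2a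
`integrable_twoTermIntegrand_vertical`). [cite: MoeglinWaldspurger1995, II.2.2] -/
theorem integrable_vectorIntegrand_vertical_axis {f : α → ℝ → ℂ} {f' : β → ℝ → ℂ}
    (hf : ∀ a, ContDiff ℝ 2 (f a)) (hfs : ∀ a, HasCompactSupport (f a)) (hf0 : ∀ a, tsupport (f a) ⊆ Ioi 0)
    (hf' : ∀ b, ContDiff ℝ 2 (f' b)) (hf's : ∀ b, HasCompactSupport (f' b)) (hf'0 : ∀ b, tsupport (f' b) ⊆ Ioi 0) {κ σ₀ : ℝ} (hσ₀ : κ < σ₀) (ρ : ℂ)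
    (φ : α → V) (φ' : β → V) (M : ℂ → V →ₗ[ℂ] V)
    {U : Set ℂ} (hUo : IsOpen U) (hUs : {z : ℂ | κ ≤ z.re ∧ z.re ≤ σ₀} ⊆ U) (S : Finset ℝ) (hS : ∀ c ∈ S, κ < c)
    (hs : ∀ a b, DifferentiableOn ℂ (fun z : ℂ => ⟪φ' b, M z (φ a)⟫_ℂ) (U \ ((S.image fun c : ℝ => (c : ℂ)) : Set ℂ)))
    {B : ℝ} (hB : ∀ a b, ∀ z : ℂ, κ < z.re → z.re ≤ σ₀ → 1 ≤ |z.im| → ‖⟪φ' b, M z (φ a)⟫_ℂ‖ ≤ B) {σ : ℝ} (hσ₁ : κ ≤ σ) (hσ₂ : σ ≤ σ₀) (hσ : ∀ c ∈ S, σ ≠ c) :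
    Integrable fun y : ℝ => ⟪∑ b, mellin (f' b) (conj ((σ : ℂ) + y * I) - ρ) • φ' b, ∑ a, mellin (f a) (-((σ : ℂ) + y * I)) • φ a⟫_ℂ +
      ⟪∑ b, mellin (f' b) (-conj ((σ : ℂ) + y * I)) • φ' b, M ((σ : ℂ) + y * I) (∑ a, mellin (f a) (-((σ : ℂ) + y * I)) • φ a)⟫_ℂ := by
  have h := integrable_finsetSum Finset.univ fun a (_ : a ∈ Finset.univ) => integrable_finsetSum Finset.univ fun b (_ : b ∈ Finset.univ) =>
    integrable_twoTermIntegrand_vertical (hf a) (hfs a) (hf0 a) (hf' b) (hf's b) (hf'0 b) ρ ⟪φ' b, φ a⟫_ℂ hσ₀ hUo hUs (hs a b) hS (hB a b) hσ₁ hσ₂ hσ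
  exact h.congr (Eventually.of_forall fun y => (vectorIntegrand_eq_sum_sum_axis f f' φ φ' M ρ _).symm)

/-! ## §2 HEAD: the vector two-term formula moved to the axis `Re z = κ` -/

/-- **HEAD — THE VECTOR TWO-TERM FORMULA MOVED TO AN ARBITRARY AXIS ACROSS FINITELY MANY SIMPLE REAL POLES (ON LETTERS).**  Data: a complex inner-product space `V`; finite families of
test functions `f_a, f′_b ∈ C²_c((0,∞))` and vectors `φ_a, φ′_b ∈ V` (transforms `Ψ̂(w) = Σ_a f̃_a(w)•φ_a`, `Ψ̂′(w) = Σ_b f̃′_b(w)•φ′_b`); reals `κ < σ₀`; the reflection point `ρ ∈ ℂ`;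
the operator datum `M : ℂ → End V` with ENTRY LETTERS (★ PB-2a's, per `(a,b)`): `hs` holomorphy of `z ↦ ⟪φ′_b, M(z)φ_a⟫` on an open `U ⊇ {κ ≤ Re z ≤ σ₀}` off a finset `S ⊂ (κ, σ₀)` of
real poles, `hr` residues `(z − c)·⟪φ′_b, M(z)φ_a⟫ → ⟪φ′_b, R_c φ_a⟫` (`R_c ∈ End V`), `hB` the strip bound at `|Im z| ≥ 1`; and the two-term identity on `Re z = σ₀`
**(hIP)** `IP = C·((2π)⁻¹·∫_ℝ (⟪Ψ̂′(z̄ − ρ), Ψ̂(−z)⟫ + ⟪Ψ̂′(−z̄), M(z)Ψ̂(−z)⟫) dy)`.  CONCLUSION: **`IP = C·(Σ_{c∈S} ⟪Ψ̂′(−c), R_c Ψ̂(−c)⟫) + C·((2π)⁻¹·∫_ℝ (same at z = κ+iy) dy)`**; the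
axis integrand is `L¹` by `integrable_vectorIntegrand_vertical_axis`.  `(κ, ρ) = (½, 1)` is ★ `pseudoEisenstein_contourShift_vector_of_letters` (spelling `z̄ − 1`); `(1, 2)` is §4.
[cite: MoeglinWaldspurger1995, II.2.1, II.2.4, IV.1.11] [cite: Titchmarsh1939, §3.12] -/
theorem pseudoEisenstein_contourShift_vector_axis_of_letters {f : α → ℝ → ℂ} {f' : β → ℝ → ℂ}
    (hf : ∀ a, ContDiff ℝ 2 (f a)) (hfs : ∀ a, HasCompactSupport (f a)) (hf0 : ∀ a, tsupport (f a) ⊆ Ioi 0)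
    (hf' : ∀ b, ContDiff ℝ 2 (f' b)) (hf's : ∀ b, HasCompactSupport (f' b)) (hf'0 : ∀ b, tsupport (f' b) ⊆ Ioi 0) {κ σ₀ : ℝ} (hσ₀ : κ < σ₀) (ρ : ℂ)
    (φ : α → V) (φ' : β → V) (M : ℂ → V →ₗ[ℂ] V)
    {U : Set ℂ} (hUo : IsOpen U) (hUs : {z : ℂ | κ ≤ z.re ∧ z.re ≤ σ₀} ⊆ U) (S : Finset ℝ) (hS : ∀ c ∈ S, κ < c ∧ c < σ₀)
    (hs : ∀ a b, DifferentiableOn ℂ (fun z : ℂ => ⟪φ' b, M z (φ a)⟫_ℂ) (U \ ((S.image fun c : ℝ => (c : ℂ)) : Set ℂ)))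
    (R : ℝ → V →ₗ[ℂ] V) (hr : ∀ a b, ∀ c ∈ S, Tendsto (fun z : ℂ => (z - c) * ⟪φ' b, M z (φ a)⟫_ℂ) (𝓝[≠] (c : ℂ)) (𝓝 ⟪φ' b, R c (φ a)⟫_ℂ))
    {B : ℝ} (hB : ∀ a b, ∀ z : ℂ, κ < z.re → z.re ≤ σ₀ → 1 ≤ |z.im| → ‖⟪φ' b, M z (φ a)⟫_ℂ‖ ≤ B)
    {IP C : ℂ} (hIP : IP = C * ((((2 * π)⁻¹ : ℝ) : ℂ) * ∫ y : ℝ,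
      (⟪∑ b, mellin (f' b) (conj ((σ₀ : ℂ) + y * I) - ρ) • φ' b, ∑ a, mellin (f a) (-((σ₀ : ℂ) + y * I)) • φ a⟫_ℂ +
        ⟪∑ b, mellin (f' b) (-conj ((σ₀ : ℂ) + y * I)) • φ' b, M ((σ₀ : ℂ) + y * I) (∑ a, mellin (f a) (-((σ₀ : ℂ) + y * I)) • φ a)⟫_ℂ))) :
    IP = C * (∑ c ∈ S, ⟪∑ b, mellin (f' b) (-(c : ℂ)) • φ' b, R c (∑ a, mellin (f a) (-(c : ℂ)) • φ a)⟫_ℂ) +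
      C * ((((2 * π)⁻¹ : ℝ) : ℂ) * ∫ y : ℝ,
        (⟪∑ b, mellin (f' b) (conj ((κ : ℂ) + y * I) - ρ) • φ' b, ∑ a, mellin (f a) (-((κ : ℂ) + y * I)) • φ a⟫_ℂ +
          ⟪∑ b, mellin (f' b) (-conj ((κ : ℂ) + y * I)) • φ' b, M ((κ : ℂ) + y * I) (∑ a, mellin (f a) (-((κ : ℂ) + y * I)) • φ a)⟫_ℂ)) := by
  have hS' : ∀ c ∈ S, κ < c := fun c hc => (hS c hc).1
  -- integrability of every entry on the two lines, to swap `∫` and `Σ`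
  have hint : ∀ {σ : ℝ}, κ ≤ σ → σ ≤ σ₀ → (∀ c ∈ S, σ ≠ c) → ∀ a b, Integrable fun y : ℝ => mellin (f a) (-((σ : ℂ) + y * I)) *
      (⟪φ' b, φ a⟫_ℂ * conj (mellin (f' b) (conj ((σ : ℂ) + y * I) - ρ)) + ⟪φ' b, M ((σ : ℂ) + y * I) (φ a)⟫_ℂ * conj (mellin (f' b) (-conj ((σ : ℂ) + y * I)))) :=
    fun hσ₁ hσ₂ hσ a b => integrable_twoTermIntegrand_vertical (hf a) (hfs a) (hf0 a) (hf' b) (hf's b) (hf'0 b) ρ ⟪φ' b, φ a⟫_ℂ hσ₀ hUo hUs (hs a b) hS' (hB a b) hσ₁ hσ₂ hσ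
  have hswap : ∀ {σ : ℝ}, κ ≤ σ → σ ≤ σ₀ → (∀ c ∈ S, σ ≠ c) →
      ∫ y : ℝ, (⟪∑ b, mellin (f' b) (conj ((σ : ℂ) + y * I) - ρ) • φ' b, ∑ a, mellin (f a) (-((σ : ℂ) + y * I)) • φ a⟫_ℂ +
        ⟪∑ b, mellin (f' b) (-conj ((σ : ℂ) + y * I)) • φ' b, M ((σ : ℂ) + y * I) (∑ a, mellin (f a) (-((σ : ℂ) + y * I)) • φ a)⟫_ℂ) =
      ∑ a, ∑ b, ∫ y : ℝ, mellin (f a) (-((σ : ℂ) + y * I)) *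
        (⟪φ' b, φ a⟫_ℂ * conj (mellin (f' b) (conj ((σ : ℂ) + y * I) - ρ)) + ⟪φ' b, M ((σ : ℂ) + y * I) (φ a)⟫_ℂ * conj (mellin (f' b) (-conj ((σ : ℂ) + y * I)))) := by
    intro σ hσ₁ hσ₂ hσ
    simp_rw [vectorIntegrand_eq_sum_sum_axis]
    rw [integral_finsetSum _ fun a _ => integrable_finsetSum _ fun b _ => hint hσ₁ hσ₂ hσ a b]
    refine Finset.sum_congr rfl fun a _ => ?_
    rw [integral_finsetSum _ fun b _ => hint hσ₁ hσ₂ hσ a b]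
  have hπ : ((((2 * π)⁻¹ : ℝ) : ℂ)) * (2 * π) = 1 := by
    push_cast
    exact inv_mul_cancel₀ (mul_ne_zero two_ne_zero (ofReal_ne_zero.2 Real.pi_pos.ne'))
  rw [hIP, hswap hσ₀.le le_rfl (fun c hc => (hS c hc).2.ne'), hswap le_rfl hσ₀.le (fun c hc => (hS c hc).1.ne),
    sum_sum_integral_twoTermIntegrand_eq hf hfs hf0 hf' hf's hf'0 hσ₀ ρ hUo hUs S hS (fun a b => ⟪φ' b, φ a⟫_ℂ) (fun a b z => ⟪φ' b, M z (φ a)⟫_ℂ) hs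
      (fun a b c => ⟪φ' b, R c (φ a)⟫_ℂ) hr hB]
  simp_rw [← vectorResidue_eq_sum_sum]
  rw [mul_add, ← mul_assoc ((((2 * π)⁻¹ : ℝ) : ℂ)) (2 * π), hπ, one_mul, mul_add, add_comm]

/-! ## §3 The axis adapter: `z̄ − 2κ = −z` on `Re z = κ` -/

/-- On the axis `Re z = κ` the reflection through `ρ = 2κ` is `z ↦ −z`: `conj(κ+iy) − 2κ = −(κ+iy)`. [folklore] -/
theorem axis_conj_sub_two_mul (κ y : ℝ) : conj ((κ : ℂ) + y * I) - 2 * (κ : ℂ) = -((κ : ℂ) + y * I) := by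
  simp only [map_add, map_mul, Complex.conj_ofReal, Complex.conj_I]
  ring

/-- **THE SHIFTED FIRST TERM ON THE AXIS**: at `z = κ+iy` and `ρ = 2κ`, `⟪Ψ̂′(z̄ − ρ), Ψ̂(−z)⟫ = ⟪Ψ̂′(−z), Ψ̂(−z)⟫` — the `A(t) = Ψ̂(−(κ+it))` currency of ★
`K2E1PseudoEisensteinPlancherelIsometryOperator` §1–§2 (PB-2b's input). [cite: MoeglinWaldspurger1995, IV.1.11] -/
theorem vectorIntegrand_axis_eq (f : α → ℝ → ℂ) (f' : β → ℝ → ℂ) (φ : α → V) (φ' : β → V) (M : ℂ → V →ₗ[ℂ] V) (κ y : ℝ) :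
    ⟪∑ b, mellin (f' b) (conj ((κ : ℂ) + y * I) - 2 * (κ : ℂ)) • φ' b, ∑ a, mellin (f a) (-((κ : ℂ) + y * I)) • φ a⟫_ℂ +
        ⟪∑ b, mellin (f' b) (-conj ((κ : ℂ) + y * I)) • φ' b, M ((κ : ℂ) + y * I) (∑ a, mellin (f a) (-((κ : ℂ) + y * I)) • φ a)⟫_ℂ =
      ⟪∑ b, mellin (f' b) (-((κ : ℂ) + y * I)) • φ' b, ∑ a, mellin (f a) (-((κ : ℂ) + y * I)) • φ a⟫_ℂ +
        ⟪∑ b, mellin (f' b) (-conj ((κ : ℂ) + y * I)) • φ' b, M ((κ : ℂ) + y * I) (∑ a, mellin (f a) (-((κ : ℂ) + y * I)) • φ a)⟫_ℂ := by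
  rw [axis_conj_sub_two_mul]

/-! ## §4 The `U(2,1)` head: axis `Re z = 1`, reflection point `2`, `σ₀ > 2` -/

/-- **HEAD (`U(2,1)`) — THE VECTOR TWO-TERM FORMULA OF A τ-CUT PSEUDO-EISENSTEIN BLOCK OF `U(2,1)_{L∕L⁺}` MOVED FROM `Re z = σ₀ > 2` TO THE UNITARY AXIS `Re z = 1`, ACROSS FINITELY
MANY SIMPLE REAL POLES IN `(1, σ₀)` (ON LETTERS).**  §2 at `(κ, ρ) = (1, 2)` with the axis adapter §3 applied: from PB-1's **(hIP)**
`IP = C·((2π)⁻¹·∫_ℝ (⟪Ψ̂′(z̄ − 2), Ψ̂(−z)⟫ + ⟪Ψ̂′(−z̄), M(z)Ψ̂(−z)⟫)|_{z = σ₀+iy} dy)` (PB-1b: the diagonal bracket in the spelling `conj(mellin f′ (conj z − 2))`; PB-1c: the intertwined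
bracket through `M(z) = M(w₀,z)|_V`) and the ENTRY LETTERS `hs∕hr∕hB` of `z ↦ ⟪φ′_b, M(z)φ_a⟫` on an open `U ⊇ {1 ≤ Re z ≤ σ₀}` off a finset `S ⊂ (1, σ₀)` (in the application
`S ⊆ {2, 3∕2}`: top residues `R_2`, middle residues `R_{3∕2}`), **`IP = C·(Σ_{c∈S} ⟪Ψ̂′(−c), R_c Ψ̂(−c)⟫_V) + C·((2π)⁻¹·∫_ℝ (⟪Ψ̂′(−z), Ψ̂(−z)⟫ + ⟪Ψ̂′(−z̄), M(z)Ψ̂(−z)⟫)|_{z = 1+iy} dy)`** —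
the residual block plus the unitary-axis term in the `A(t) = Ψ̂(−(1+it))` currency of ★ `K2E1PseudoEisensteinPlancherelIsometryOperator` (PB-2b∕PB-3∕PB-4 consume it).
[cite: MoeglinWaldspurger1995, II.2.1, II.2.4, IV.1.11] [cite: Titchmarsh1939, §3.12] -/
theorem pseudoEisenstein_contourShift_vector_cm_three {f : α → ℝ → ℂ} {f' : β → ℝ → ℂ}
    (hf : ∀ a, ContDiff ℝ 2 (f a)) (hfs : ∀ a, HasCompactSupport (f a)) (hf0 : ∀ a, tsupport (f a) ⊆ Ioi 0)
    (hf' : ∀ b, ContDiff ℝ 2 (f' b)) (hf's : ∀ b, HasCompactSupport (f' b)) (hf'0 : ∀ b, tsupport (f' b) ⊆ Ioi 0) {σ₀ : ℝ} (hσ₀ : 2 < σ₀)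
    (φ : α → V) (φ' : β → V) (M : ℂ → V →ₗ[ℂ] V)
    {U : Set ℂ} (hUo : IsOpen U) (hUs : {z : ℂ | 1 ≤ z.re ∧ z.re ≤ σ₀} ⊆ U) (S : Finset ℝ) (hS : ∀ c ∈ S, 1 < c ∧ c < σ₀)
    (hs : ∀ a b, DifferentiableOn ℂ (fun z : ℂ => ⟪φ' b, M z (φ a)⟫_ℂ) (U \ ((S.image fun c : ℝ => (c : ℂ)) : Set ℂ)))
    (R : ℝ → V →ₗ[ℂ] V) (hr : ∀ a b, ∀ c ∈ S, Tendsto (fun z : ℂ => (z - c) * ⟪φ' b, M z (φ a)⟫_ℂ) (𝓝[≠] (c : ℂ)) (𝓝 ⟪φ' b, R c (φ a)⟫_ℂ))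
    {B : ℝ} (hB : ∀ a b, ∀ z : ℂ, 1 < z.re → z.re ≤ σ₀ → 1 ≤ |z.im| → ‖⟪φ' b, M z (φ a)⟫_ℂ‖ ≤ B)
    {IP C : ℂ} (hIP : IP = C * ((((2 * π)⁻¹ : ℝ) : ℂ) * ∫ y : ℝ,
      (⟪∑ b, mellin (f' b) (conj ((σ₀ : ℂ) + y * I) - 2) • φ' b, ∑ a, mellin (f a) (-((σ₀ : ℂ) + y * I)) • φ a⟫_ℂ +
        ⟪∑ b, mellin (f' b) (-conj ((σ₀ : ℂ) + y * I)) • φ' b, M ((σ₀ : ℂ) + y * I) (∑ a, mellin (f a) (-((σ₀ : ℂ) + y * I)) • φ a)⟫_ℂ))) :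
    IP = C * (∑ c ∈ S, ⟪∑ b, mellin (f' b) (-(c : ℂ)) • φ' b, R c (∑ a, mellin (f a) (-(c : ℂ)) • φ a)⟫_ℂ) +
      C * ((((2 * π)⁻¹ : ℝ) : ℂ) * ∫ y : ℝ,
        (⟪∑ b, mellin (f' b) (-((1 : ℂ) + y * I)) • φ' b, ∑ a, mellin (f a) (-((1 : ℂ) + y * I)) • φ a⟫_ℂ +
          ⟪∑ b, mellin (f' b) (-conj ((1 : ℂ) + y * I)) • φ' b, M ((1 : ℂ) + y * I) (∑ a, mellin (f a) (-((1 : ℂ) + y * I)) • φ a)⟫_ℂ)) := by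
  have h1σ₀ : (1 : ℝ) < σ₀ := by linarith
  have h := pseudoEisenstein_contourShift_vector_axis_of_letters hf hfs hf0 hf' hf's hf'0 h1σ₀ (2 : ℂ) φ φ' M hUo hUs S hS hs R hr hB hIP
  have hax : ∀ y : ℝ, conj (((1 : ℝ) : ℂ) + y * I) - 2 = conj (((1 : ℝ) : ℂ) + y * I) - 2 * (((1 : ℝ) : ℂ)) := fun y => by push_cast; ring
  simp_rw [hax, vectorIntegrand_axis_eq, ofReal_one] at h
  exact h

end Summit.HodgeConjecture.HodgeConjecture.Cruxes.H413.K2E1PseudoEisensteinContourShiftVectorAxisGeneric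

end
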